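import Summits.QuantumFields.YangMills.Theorems.ColdStartUniversalityLatticeLangevinUniquenessVec
import HarnessLib

/-!
# Route `ColdStartUniversality` (rung input (M) groundwork, crux K_A1 stmt-QuantumFields-24809): continuous dependence
# on the initial datum for Lipschitz SDE systems driven by a Brownian vector — bounded solutions, `L²(sup)` form

Helper file (seat `ym-line-csu-p1`).  For the vector systems `dX_i = b_i(X) dt + Σₙ σ_{i n}(X) dW^{c i n}` of
`…ColdStartSolutionsExistVecPicard` (globally Lipschitz coefficients), two coordinatewise progressive, a.s. continuous, a.s.
bounded solutions `Y`, `Y'` on one probability space, driven by the same Brownian vector, started at `x₀`, `x₀'`, satisfy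

  `E[sup_{s≤t} |Y_s − Y'_s|²] ≤ 2 |x₀ − x₀'|² · exp(2 C_T t)`   (`t ≤ T`, `C_T` the constant of `vecPicard_contraction`)

(`vecSDE_lintegral_iSup_sub_sq_le`).  Proof: the Picard step from the COMMON start `x₀` applied to `Y'` is `Y' − (x₀' − x₀)`
a.s., so `vecPicard_contraction` bounds `E sup |Y − Y' + (x₀' − x₀)|²` by `C_T E∫₀ᵗ|Y − Y'|²`; then Gronwall's lemma with
forcing (`lintegral_iSup_sq_le_gronwall`, the `ℝ≥0∞` packaging of the tree's `gronwall_of_le_integral`, RY Appendix §1).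
This is the Feller-continuity input of the Markov-semigroup route (Doob's theorem) to the rung's open input (M); it also
re-proves pathwise uniqueness (`x₀ = x₀'`).  No definition, no sorry.  RECORD-rung R3 plumbing; nothing here bears on the mass gap. -/

set_option autoImplicit false

noncomputable section

namespace Summit.QuantumFields.YangMills.Theorems.ColdStartUniversality

open MeasureTheory ProbabilityTheory Filter Topology Finset
open scoped NNReal ENNReal BigOperators
open Literature.Probability.Process Literature.Analysis.FunctionSpaces

section Gronwall

variable {Ω : Type*} {mΩ : MeasurableSpace Ω} {P : Measure Ω}

/-- **Gronwall with forcing, `ℝ≥0∞` packaging** (RY Appendix §1): if `D` is jointly measurable, a.s. bounded, and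
`E[sup_{s≤t} D_s²] ≤ A + C · E∫₀ᵗ D_r² dr` for `t ≤ T` with finite `A`, `C`, then
`E[sup_{s≤t} D_s²] ≤ A · exp(C t)` for `t ≤ T`. [cite: RevuzYor1999, Appendix §1 (Gronwall's lemma)] -/
theorem lintegral_iSup_sq_le_gronwall [IsFiniteMeasure P] {D : ℝ≥0 → Ω → ℝ}
    (hD : Measurable (fun p : ℝ≥0 × Ω => D p.1 p.2)) {M : ℝ} (hM : ∀ᵐ ω ∂P, ∀ s, |D s ω| ≤ M)
    {T : ℝ≥0} {A C : ℝ≥0∞} (hA : A ≠ ∞) (hC : C ≠ ∞)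
    (hle : ∀ t ≤ T, ∫⁻ ω, ⨆ s ∈ Set.Iic t, ENNReal.ofReal (D s ω ^ 2) ∂P ≤
      A + C * ∫⁻ ω, (∫⁻ r in Set.Icc (0 : ℝ) t, ENNReal.ofReal (D r.toNNReal ω ^ 2)) ∂P) :
    ∀ t ≤ T, ∫⁻ ω, ⨆ s ∈ Set.Iic t, ENNReal.ofReal (D s ω ^ 2) ∂P ≤
      A * ENNReal.ofReal (Real.exp (C.toReal * t)) := by
  set Φ : ℝ≥0 → ℝ≥0∞ := fun t => ∫⁻ ω, ⨆ s ∈ Set.Iic t, ENNReal.ofReal (D s ω ^ 2) ∂P with hΦ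
  have hΦmono : Monotone Φ := fun t t' h =>
    lintegral_mono fun ω => biSup_mono fun s (hs : s ∈ Set.Iic t) => Set.mem_Iic.2 (hs.trans h)
  have hΦbdd : ∀ t, Φ t ≤ ENNReal.ofReal (M ^ 2) * P Set.univ := by
    intro t
    calc Φ t ≤ ∫⁻ _, ENNReal.ofReal (M ^ 2) ∂P := by
          refine lintegral_mono_ae (hM.mono fun ω hω => iSup₂_le fun s _ => ?_)
          refine ENNReal.ofReal_le_ofReal ?_
          have h1 := hω s
          have h2 : |D s ω| ^ 2 ≤ M ^ 2 := pow_le_pow_left₀ (abs_nonneg _) h1 2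
          rwa [sq_abs] at h2
      _ = ENNReal.ofReal (M ^ 2) * P Set.univ := lintegral_const _
  have hΦfin : ∀ t, Φ t < ∞ := fun t =>
    (hΦbdd t).trans_lt (ENNReal.mul_lt_top ENNReal.ofReal_lt_top (measure_lt_top _ _))
  have hmeas2 : Measurable (fun q : Ω × ℝ => ENNReal.ofReal (D q.2.toNNReal q.1 ^ 2)) := by
    have : Measurable (fun q : Ω × ℝ => D q.2.toNNReal q.1) :=
      hD.comp ((measurable_real_toNNReal.comp measurable_snd).prodMk measurable_fst)
    exact (this.pow_const 2).ennreal_ofReal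
  have hswap : ∀ t : ℝ≥0, ∫⁻ ω, (∫⁻ r in Set.Icc (0 : ℝ) t, ENNReal.ofReal (D r.toNNReal ω ^ 2)) ∂P ≤
      ∫⁻ r in Set.Icc (0 : ℝ) t, Φ r.toNNReal := by
    intro t
    rw [lintegral_lintegral_swap (hmeas2.aemeasurable)]
    refine lintegral_mono fun r => lintegral_mono fun ω => ?_
    exact le_iSup₂_of_le r.toNNReal (Set.mem_Iic.2 le_rfl) le_rfl
  set φ : ℝ → ℝ := fun r => (Φ r.toNNReal).toReal with hφ
  have hφmono : Monotone φ := fun r r' h =>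
    ENNReal.toReal_mono (hΦfin _).ne (hΦmono (Real.toNNReal_le_toNNReal h))
  have hφm : Measurable φ := hφmono.measurable
  have hφ0 : ∀ r, 0 ≤ φ r := fun r => ENNReal.toReal_nonneg
  obtain ⟨Cb, hCb⟩ : ∃ Cb, ∀ r, φ r ≤ Cb :=
    ⟨(ENNReal.ofReal (M ^ 2) * P Set.univ).toReal, fun r => ENNReal.toReal_mono
      (ENNReal.mul_ne_top ENNReal.ofReal_ne_top (measure_ne_top _ _)) (hΦbdd _)⟩
  have hφint : ∀ t : ℝ, IntegrableOn φ (Set.Icc 0 t) := fun t =>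
    Measure.integrableOn_of_bounded (M := Cb) measure_Icc_lt_top.ne hφm.aestronglyMeasurable
      (ae_of_all _ fun r => by rw [Real.norm_eq_abs, abs_of_nonneg (hφ0 r)]; exact hCb r)
  -- the integral inequality in real form
  have hkey : ∀ t ∈ Set.Icc 0 (T : ℝ), φ t ≤ A.toReal + C.toReal * ∫ r in (0 : ℝ)..t, φ r := by
    intro t ht
    have ht' : t.toNNReal ≤ T := Real.toNNReal_le_iff_le_coe.2 ht.2
    have h1 := (hle _ ht').trans (add_le_add le_rfl (mul_le_mul' le_rfl (hswap _)))
    rw [Real.coe_toNNReal _ ht.1] at h1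
    have h2 : ∫⁻ r in Set.Icc (0 : ℝ) t, Φ r.toNNReal = ENNReal.ofReal (∫ r in (0 : ℝ)..t, φ r) := by
      rw [intervalIntegral.integral_of_le ht.1, ← integral_Icc_eq_integral_Ioc,
        ofReal_integral_eq_lintegral_ofReal (hφint t) (ae_of_all _ fun r => hφ0 r)]
      refine setLIntegral_congr_fun measurableSet_Icc fun r _ => ?_
      rw [hφ, ENNReal.ofReal_toReal (hΦfin _).ne]
    rw [h2] at h1
    have hI0 : 0 ≤ ∫ r in (0 : ℝ)..t, φ r := intervalIntegral.integral_nonneg ht.1 fun r _ => hφ0 r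
    have h3 := ENNReal.toReal_mono (ENNReal.add_ne_top.2 ⟨hA, ENNReal.mul_ne_top hC ENNReal.ofReal_ne_top⟩) h1
    rwa [ENNReal.toReal_add hA (ENNReal.mul_ne_top hC ENNReal.ofReal_ne_top), ENNReal.toReal_mul,
      ENNReal.toReal_ofReal hI0] at h3
  have hgr := gronwall_of_le_integral (a := A.toReal) (b := C.toReal) ENNReal.toReal_nonneg T.coe_nonneg hφm
    (fun r _ => hφ0 r) ⟨Cb, fun r _ => hCb r⟩ hkey
  intro t ht
  have h1 := hgr t ⟨t.coe_nonneg, NNReal.coe_le_coe.2 ht⟩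
  have h2 : φ (t : ℝ) = (Φ t).toReal := by simp only [hφ, Real.toNNReal_coe]
  rw [h2] at h1
  change Φ t ≤ _
  calc Φ t = ENNReal.ofReal ((Φ t).toReal) := (ENNReal.ofReal_toReal (hΦfin t).ne).symm
    _ ≤ ENNReal.ofReal (A.toReal * Real.exp (C.toReal * t)) := ENNReal.ofReal_le_ofReal h1
    _ = A * ENNReal.ofReal (Real.exp (C.toReal * t)) := by
        rw [ENNReal.ofReal_mul ENNReal.toReal_nonneg, ENNReal.ofReal_toReal hA]

end Gronwall

section ContDep

variable {Ω : Type*} {mΩ : MeasurableSpace Ω} {P : Measure Ω} {d : ℕ}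
  {W : ℝ≥0 → Ω → (Fin d → ℝ)} {ι κ : Type*} [Fintype ι] [Fintype κ]
  {b : (ι → ℝ) → ι → ℝ} {σ : (ι → ℝ) → ι → κ → ℝ} {c : ι → κ → Fin d} {K : ℝ} {x₀ x₀' : ι → ℝ}

/-- **Continuous dependence on the initial datum in `L²(sup)`** (RY IX §2, the a priori estimate behind Thm (2.1) and the flow
of Thm (2.4)): two bounded solutions of a Lipschitz system driven by the same Brownian vector, from `x₀` and `x₀'`, satisfy
`E[sup_{s≤t} |Y_s − Y'_s|²] ≤ 2|x₀ − x₀'|² exp(2 C_T t)` for `t ≤ T`. [cite: RevuzYor1999, Ch. IX Thm (2.1)] -/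
theorem vecSDE_lintegral_iSup_sub_sq_le [IsProbabilityMeasure P] (hW : IsBrownianVec W P) (hK : 0 ≤ K)
    (hb : ∀ x y : ι → ℝ, ∑ i, (b x i - b y i) ^ 2 ≤ K * ∑ i, (x i - y i) ^ 2)
    (hσ : ∀ x y : ι → ℝ, ∑ i, ∑ n, (σ x i n - σ y i n) ^ 2 ≤ K * ∑ i, (x i - y i) ^ 2)
    {Y Y' : ι → ℝ≥0 → Ω → ℝ} {J J' : ι → κ → ℝ≥0 → Ω → ℝ}
    (hYp : ∀ i, IsStronglyProgressive hW.natFiltration (Y i))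
    (hYc : ∀ᵐ ω ∂P, ∀ i, Continuous fun t => Y i t ω)
    (hY'p : ∀ i, IsStronglyProgressive hW.natFiltration (Y' i))
    (hY'c : ∀ᵐ ω ∂P, ∀ i, Continuous fun t => Y' i t ω)
    (hJ : ∀ i n, IsItoIntegral (fun s ω => σ (fun j => Y j s ω) i n) (fun s ω => W s ω (c i n)) (J i n)
        hW.natFiltration P)
    (hJ' : ∀ i n, IsItoIntegral (fun s ω => σ (fun j => Y' j s ω) i n) (fun s ω => W s ω (c i n)) (J' i n)
        hW.natFiltration P)
    (hYeq : ∀ᵐ ω ∂P, ∀ (t : ℝ≥0) (i : ι),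
      Y i t ω = x₀ i + (∫ s in (0 : ℝ)..t, b (fun j => Y j s.toNNReal ω) i) + ∑ n, J i n t ω)
    (hY'eq : ∀ᵐ ω ∂P, ∀ (t : ℝ≥0) (i : ι),
      Y' i t ω = x₀' i + (∫ s in (0 : ℝ)..t, b (fun j => Y' j s.toNNReal ω) i) + ∑ n, J' i n t ω)
    {M : ℝ} (hbd : ∀ᵐ ω ∂P, ∀ (t : ℝ≥0) (i : ι), |Y i t ω| ≤ M ∧ |Y' i t ω| ≤ M) (T : ℝ≥0) :
    ∀ t ≤ T, ∫⁻ ω, ⨆ s ∈ Set.Iic t, ENNReal.ofReal (∑ i, (Y i s ω - Y' i s ω) ^ 2) ∂P ≤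
      ENNReal.ofReal (2 * ∑ i, (x₀ i - x₀' i) ^ 2) *
        ENNReal.ofReal (Real.exp ((2 * ((Fintype.card ι : ℝ≥0∞) * ENNReal.ofReal (2 * T * K) +
          8 * (Fintype.card ι : ℝ≥0∞) * (Fintype.card κ : ℝ≥0∞) ^ 2 * ENNReal.ofReal K)).toReal * t)) := by
  classical
  -- progressive versions of the Itô integrals
  have hJv : ∀ i n, ∃ V : ℝ≥0 → Ω → ℝ,
      IsItoIntegral (fun s ω => σ (fun j => Y j s ω) i n) (fun s ω => W s ω (c i n)) V hW.natFiltration P ∧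
        IsStronglyProgressive hW.natFiltration V ∧ ∀ᵐ ω ∂P, ∀ t, V t ω = J i n t ω := fun i n => by
    obtain ⟨V, h1, h2, -, h3⟩ := (hJ i n).exists_isStronglyProgressive
    exact ⟨V, h1, h2, h3⟩
  have hJv' : ∀ i n, ∃ V : ℝ≥0 → Ω → ℝ,
      IsItoIntegral (fun s ω => σ (fun j => Y' j s ω) i n) (fun s ω => W s ω (c i n)) V hW.natFiltration P ∧
        IsStronglyProgressive hW.natFiltration V ∧ ∀ᵐ ω ∂P, ∀ t, V t ω = J' i n t ω := fun i n => by
    obtain ⟨V, h1, h2, -, h3⟩ := (hJ' i n).exists_isStronglyProgressive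
    exact ⟨V, h1, h2, h3⟩
  choose JV hJV1 hJV2 hJV3 using hJv
  choose JV' hJV'1 hJV'2 hJV'3 using hJv'
  -- Picard steps from the COMMON start `x₀`
  set V : ι → ℝ≥0 → Ω → ℝ := fun i t ω =>
    x₀ i + timeIntegral (fun s ω => b (fun j => Y j s ω) i) t ω + ∑ n, JV i n t ω with hVdef
  set V' : ι → ℝ≥0 → Ω → ℝ := fun i t ω =>
    x₀ i + timeIntegral (fun s ω => b (fun j => Y' j s ω) i) t ω + ∑ n, JV' i n t ω with hV'def
  have hJVae : ∀ᵐ ω ∂P, ∀ i n t, JV i n t ω = J i n t ω := by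
    have h := fun i => (ae_all_iff.2 fun n => hJV3 i n)
    exact (ae_all_iff.2 h).mono fun ω hω i n t => hω i n t
  have hJV'ae : ∀ᵐ ω ∂P, ∀ i n t, JV' i n t ω = J' i n t ω := by
    have h := fun i => (ae_all_iff.2 fun n => hJV'3 i n)
    exact (ae_all_iff.2 h).mono fun ω hω i n t => hω i n t
  have hVY : ∀ᵐ ω ∂P, ∀ (t : ℝ≥0) (i : ι), V i t ω = Y i t ω := by
    filter_upwards [hYeq, hJVae] with ω hω hωJ t i
    rw [hω t i, hVdef]
    simp only [timeIntegral, hωJ]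
  have hV'Y' : ∀ᵐ ω ∂P, ∀ (t : ℝ≥0) (i : ι), V' i t ω = Y' i t ω - (x₀' i - x₀ i) := by
    filter_upwards [hY'eq, hJV'ae] with ω hω hωJ t i
    rw [hω t i, hV'def]
    simp only [timeIntegral, hωJ]
    ring
  have hcontr := vecPicard_contraction (x₀ := x₀) hW hK hb hσ hYp hYc hY'p hY'c
    (fun i n => ⟨hJV1 i n, hJV2 i n⟩) (fun i t ω => rfl) (fun i n => ⟨hJV'1 i n, hJV'2 i n⟩)
    (fun i t ω => rfl) T
  -- the difference process
  set D : ℝ≥0 → Ω → ℝ := fun s ω => Real.sqrt (∑ i, (Y i s ω - Y' i s ω) ^ 2) with hDdef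
  have hDsq : ∀ s ω, D s ω ^ 2 = ∑ i, (Y i s ω - Y' i s ω) ^ 2 := fun s ω =>
    Real.sq_sqrt (Finset.sum_nonneg fun _ _ => sq_nonneg _)
  have hDm : Measurable (fun p : ℝ≥0 × Ω => D p.1 p.2) := by
    have h : ∀ i, Measurable (fun p : ℝ≥0 × Ω => Y i p.1 p.2 - Y' i p.1 p.2) := fun i =>
      (IsStronglyProgressive.measurable_uncurry (hYp i)).sub (IsStronglyProgressive.measurable_uncurry (hY'p i))
    exact (Finset.measurable_sum _ fun i _ => (h i).pow_const 2).sqrt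
  have hDbd : ∀ᵐ ω ∂P, ∀ s, |D s ω| ≤ Real.sqrt (Fintype.card ι * (2 * |M|) ^ 2) := by
    filter_upwards [hbd] with ω hω s
    rw [abs_of_nonneg (Real.sqrt_nonneg _)]
    refine Real.sqrt_le_sqrt ?_
    calc ∑ i, (Y i s ω - Y' i s ω) ^ 2 ≤ ∑ _i : ι, (2 * |M|) ^ 2 := by
          refine Finset.sum_le_sum fun i _ => ?_
          have h1 := (hω s i).1
          have h2 := (hω s i).2
          have h3 : |Y i s ω - Y' i s ω| ≤ 2 * |M| :=
            (abs_sub _ _).trans (by linarith [le_abs_self M])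
          rw [← sq_abs]
          exact pow_le_pow_left₀ (abs_nonneg _) h3 2
      _ = Fintype.card ι * (2 * |M|) ^ 2 := by rw [Finset.sum_const, Finset.card_univ, nsmul_eq_mul]
  -- the forced inequality
  set Cc : ℝ≥0∞ := (Fintype.card ι : ℝ≥0∞) * ENNReal.ofReal (2 * T * K) +
      8 * (Fintype.card ι : ℝ≥0∞) * (Fintype.card κ : ℝ≥0∞) ^ 2 * ENNReal.ofReal K with hCc
  have hCc_ne : Cc ≠ ∞ :=
    ENNReal.add_ne_top.2 ⟨ENNReal.mul_ne_top (ENNReal.natCast_ne_top _) ENNReal.ofReal_ne_top,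
      ENNReal.mul_ne_top (ENNReal.mul_ne_top (ENNReal.mul_ne_top (by norm_num) (ENNReal.natCast_ne_top _))
        (ENNReal.pow_ne_top (ENNReal.natCast_ne_top _))) ENNReal.ofReal_ne_top⟩
  set a : ℝ := ∑ i, (x₀ i - x₀' i) ^ 2 with ha
  have ha0 : 0 ≤ a := Finset.sum_nonneg fun _ _ => sq_nonneg _
  have hforced : ∀ t ≤ T, ∫⁻ ω, ⨆ s ∈ Set.Iic t, ENNReal.ofReal (D s ω ^ 2) ∂P ≤
      ENNReal.ofReal (2 * a) + (2 * Cc) * ∫⁻ ω, (∫⁻ r in Set.Icc (0 : ℝ) t, ENNReal.ofReal (D r.toNNReal ω ^ 2)) ∂P := by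
    intro t ht
    have h1 := hcontr t ht
    -- pointwise: Σ (Y-Y')² ≤ 2 Σ (V-V')² + 2 a
    have hpt : ∀ᵐ ω ∂P, (⨆ s ∈ Set.Iic t, ENNReal.ofReal (D s ω ^ 2)) ≤
        ENNReal.ofReal (2 * a) + 2 * ⨆ s ∈ Set.Iic t, ENNReal.ofReal (∑ i, (V i s ω - V' i s ω) ^ 2) := by
      filter_upwards [hVY, hV'Y'] with ω h h'
      refine iSup₂_le fun s hs => ?_
      have hcoord : ∀ i, (Y i s ω - Y' i s ω) ^ 2 ≤ 2 * (V i s ω - V' i s ω) ^ 2 + 2 * (x₀ i - x₀' i) ^ 2 := by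
        intro i
        rw [h s i, h' s i]
        nlinarith [sq_nonneg (Y i s ω - Y' i s ω + 2 * (x₀' i - x₀ i))]
      have hsum : ∑ i, (Y i s ω - Y' i s ω) ^ 2 ≤ 2 * ∑ i, (V i s ω - V' i s ω) ^ 2 + 2 * a := by
        rw [ha, Finset.mul_sum, Finset.mul_sum, ← Finset.sum_add_distrib]
        exact Finset.sum_le_sum fun i _ => hcoord i
      rw [hDsq]
      calc ENNReal.ofReal (∑ i, (Y i s ω - Y' i s ω) ^ 2)
          ≤ ENNReal.ofReal (2 * ∑ i, (V i s ω - V' i s ω) ^ 2 + 2 * a) := ENNReal.ofReal_le_ofReal hsum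
        _ = 2 * ENNReal.ofReal (∑ i, (V i s ω - V' i s ω) ^ 2) + ENNReal.ofReal (2 * a) := by
            rw [ENNReal.ofReal_add (by positivity) (by positivity), ENNReal.ofReal_mul zero_le_two,
              ENNReal.ofReal_ofNat]
        _ ≤ 2 * (⨆ s ∈ Set.Iic t, ENNReal.ofReal (∑ i, (V i s ω - V' i s ω) ^ 2)) + ENNReal.ofReal (2 * a) := by
            gcongr
            exact le_iSup₂_of_le s hs le_rfl
        _ = _ := add_comm _ _
    calc ∫⁻ ω, ⨆ s ∈ Set.Iic t, ENNReal.ofReal (D s ω ^ 2) ∂P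
        ≤ ∫⁻ ω, (ENNReal.ofReal (2 * a) + 2 * ⨆ s ∈ Set.Iic t, ENNReal.ofReal (∑ i, (V i s ω - V' i s ω) ^ 2)) ∂P :=
          lintegral_mono_ae hpt
      _ = ENNReal.ofReal (2 * a) + 2 * ∫⁻ ω, ⨆ s ∈ Set.Iic t, ENNReal.ofReal (∑ i, (V i s ω - V' i s ω) ^ 2) ∂P := by
          rw [lintegral_add_left measurable_const, lintegral_const, measure_univ, mul_one,
            lintegral_const_mul' _ _ (by norm_num)]
      _ ≤ ENNReal.ofReal (2 * a) + 2 * (Cc * ∫⁻ ω, (∫⁻ r in Set.Icc (0 : ℝ) t,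
            ENNReal.ofReal (∑ i, (Y i r.toNNReal ω - Y' i r.toNNReal ω) ^ 2)) ∂P) := by
          gcongr
      _ = _ := by
          rw [mul_assoc]
          congr 2
          simp only [hDsq]
  have hgr := lintegral_iSup_sq_le_gronwall hDm hDbd (T := T) (A := ENNReal.ofReal (2 * a)) (C := 2 * Cc)
    ENNReal.ofReal_ne_top (ENNReal.mul_ne_top (by norm_num) hCc_ne) hforced
  intro t ht
  have h := hgr t ht
  simp only [hDsq] at h
  rw [hCc] at h
  exact h

end ContDep

end Summit.QuantumFields.YangMills.Theorems.ColdStartUniversality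

end
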